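import Literature.Probability.LatticeModels.CriticalTwoPointDCPLowerHolds
import HarnessLib

/-!
# The engine one level down: the screened torus Lemma 2.5 follows from a screening bound for ONE
# sourced current (line `source-cluster-screening`, crux stmt-CriticalPhenomena-15703
# `Summit.CriticalPhenomena.Ising3DConformalLimit.Theses.SubPtolemyInterlacing.SubPtolemyFloor`, engine
# stub `stub_screenedLemma25`; lead seat `prover-line-stmt-CriticalPhenomena-15703-c3-0`)

The engine of the line asks for Duminil-Copin–Panis' Lemma 2.5 (arXiv:2404.05700, §2.2), summed over the
neighbour pairs `x ∼ y` of `Λ_n` on the even torus at `β_c(3)`, with a polynomial gain `C n^{-s}`: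
`Σ_{x∼y} 𝐄^∅[𝟙_{0,x ∈ 𝒮¹, y ↔ ℍ} ⟨σ₀σ_x⟩_{𝒮¹}]·Z^∅ ≤ C n^{-s} Σ_{x∼y} (Z^{0x} - Z^{0,θx}) ⟨σ_yσ_{θy}⟩_𝕋`.
The printed proof of Lemma 2.5 has five steps (tree `IsFoldable.lemma25`): (1) Griffiths `𝒮¹ ⊆ 𝒢`,
(2) the domain-Markov identity on `𝒢` (`IsFoldable.tsum_gset_markov`, an EQUALITY turning the sourceless
expectation of `⟨σ₀σ_x⟩_{𝒢}` into the SOURCED current event `Z^{0x}[0,x ↮ ℍ, y ↔ ℍ]`), (3) conditioning on the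
source cluster `𝒞(0)`, (4) outer switching + Griffiths `⟨σ_yσ_{θy}⟩_{Λ∖𝒞} ≤ ⟨σ_yσ_{θy}⟩_Λ` — the step that
DISCARDS THE SCREENING of the reflected connection of `y` by the deleted cluster `𝒞(0) ∋ x ∼ y` — and
(5) un-conditioning `Σ_S Z^{0x}[𝒞 = S] = Z^{0x} - Z^{0,θx}`.

This file proves that the engine is implied by the same gain stated AFTER steps (1)–(2), i.e. for the pure
random-current quantity of ONE sourced current (no spin two-point function in a random volume any more):

* `foldable_volume_markov_le` — steps (1)–(2) for an abstract fold datum (per pair):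
  `Σ_{∂𝐧=∅} w(𝐧) 𝟙[o,x ∈ W(𝐧), y ↔ ℍ] ⟨σ_oσ_x⟩_{W(𝐧)} ≤ Σ_{∂𝐧={o,x}} w(𝐧) 𝟙[o,x ↮ ℍ, y ↔ ℍ]`;
* `torus_volume_markov_le` — the same on the even torus `(ℤ/Lℤ)^d` for box points (the hyperplane case is `0 ≤ …`);
* `screenedLemma25_of_screenedSourcedEvent` — **reduction of the engine**: for every `s, C`, the screened
  SOURCED-EVENT bound `Σ_{x∼y} Z^{0̄x̄}[0̄,x̄ ↮ ℍ_δ, ȳ ↔ ℍ_δ] ≤ C n^{-s} Σ_{x∼y} (Z^{0̄x̄} - Z^{0̄,θx̄}) ⟨σ_ȳσ_{θȳ}⟩_𝕋`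
  (all `n ≥ 1`, even `L ≥ 4n+2`, directions `δ`, at `β_c(3)`) implies the engine's `ScreenedTorusLemma25 s C`
  (unfolded). By (3) and the exact outer switching, `Z^{0x}[𝒞(0)=S, y ↔ ℍ] = Z^{0x}[𝒞(0)=S]·⟨σ_yσ_{θy}⟩_{Λ∖S}`, so the
  sourced-event bound is literally "the mean screening ratio `⟨σ_yσ_{θy}⟩_{Λ∖𝒞(0)}/⟨σ_yσ_{θy}⟩_Λ` of the reflected
  connection of `y` by the adjacent source cluster, averaged over pairs with the weights of `B(n)`, is `≤ C n^{-s}`";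
* `screenedSourcedEvent_zero_one` — calibration: with `s = 0`, `C = 1` the sourced-event bound is a theorem
  (steps (3)–(5), tree `IsFoldable.tsum_pair_event_le`), so its content is exactly the exponent `s`.

References: H. Duminil-Copin, R. Panis, CMP 406 (2025), arXiv:2404.05700, Lemma 2.5 and its proof,
eqs. (2.21)–(2.23); S. Friedli, Y. Velenik, CUP 2017, Exercise 3.12 (Griffiths' volume monotonicity).
-/

noncomputable section

open Finset

namespace Summit.CriticalPhenomena.Ising3DConformalLimit.SubPtolemyFloorScreening

open Literature.Probability.LatticeModels Literature.Probability.LatticeModels.DCPLower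
open scoped ENNReal symmDiff Classical

/-- **Steps (1)–(2) of the proof of Lemma 2.5, for an abstract fold datum** (per pair): Griffiths
`W(𝐧) = {v ∈ B : v ↮ ℍ} ⊆ 𝒢_𝐧` and the domain-Markov identity on `𝒢_𝐧` give
`Σ_{∂𝐧=∅} w(𝐧) 𝟙[o,x ∈ W(𝐧), y ↔ ℍ] ⟨σ_oσ_x⟩_{W(𝐧)} ≤ Σ_{∂𝐧={o}∆{x}} w(𝐧) 𝟙[o ↮ ℍ, x ↮ ℍ, y ↔ ℍ]` (the first two
steps of the tree's `IsFoldable.lemma25`, isolated). [cite: DuminilCopinPanis2025LowerBounds, Lemma 2.5 (proof, eqs. (2.21)–(2.22))] -/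
theorem foldable_volume_markov_le {V : Type*} [DecidableEq V] {G : SimpleGraph V} [G.LocallyFinite]
    {θ : V ≃ V} {Λ Hm : Finset V} (h : IsFoldable G θ Λ Hm) {β : ℝ} (hβ : 0 ≤ β) {B : Finset V}
    (hB : B ⊆ Λ) (hBfix : ∀ v ∈ B, v ∈ Hm ∨ θ v = v) {o x y : V} (ho : o ∈ Hm) (hx : x ∈ Hm) (hoB : o ∈ B)
    (hxB : x ∈ B) (hyΛ : y ∈ Λ) (hy' : y ∈ Hm ∨ θ y = y) :
    ∑' n, ind (csources G Λ n = ∅ ∧ CSupp G Λ (edgesIn G Λ) n) * cweight G Λ β n *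
        (ind (¬ h.ConnFix (h.fold n) o ∧ ¬ h.ConnFix (h.fold n) x ∧ h.ConnFix (h.fold n) y) *
          ENNReal.ofReal (isingTwoPoint G (B.filter fun v => ¬ h.ConnFix (h.fold n) v) β 0 .free o x)) ≤
      ∑' n, ind (csources G Λ n = {o} ∆ {x} ∧ CSupp G Λ (edgesIn G Λ) n) * cweight G Λ β n *
        ind (¬ h.ConnFix (h.fold n) o ∧ ¬ h.ConnFix (h.fold n) x ∧ h.ConnFix (h.fold n) y) := by
  -- Griffiths: `W(n) ⊆ 𝒢_n`
  have hS1 : ∀ n, ind (¬ h.ConnFix (h.fold n) o ∧ ¬ h.ConnFix (h.fold n) x ∧ h.ConnFix (h.fold n) y) *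
      ENNReal.ofReal (isingTwoPoint G (B.filter fun v => ¬ h.ConnFix (h.fold n) v) β 0 .free o x) ≤
      ind (¬ h.ConnFix (h.fold n) o ∧ ¬ h.ConnFix (h.fold n) x ∧ h.ConnFix (h.fold n) y) *
        ENNReal.ofReal (isingTwoPoint G (h.gset n) β 0 .free o x) := by
    intro n
    by_cases hP : ¬ h.ConnFix (h.fold n) o ∧ ¬ h.ConnFix (h.fold n) x ∧ h.ConnFix (h.fold n) y
    · refine mul_le_mul_right (ENNReal.ofReal_le_ofReal (IsFoldable.twoPoint_volume_mono hβ ?_ ?_ ?_)) _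
      · intro v hv
        obtain ⟨hvB, hvc⟩ := mem_filter.1 hv
        exact (h.mem_gset_iff_not_connFix (hB hvB) (hBfix v hvB)).2 hvc
      · exact mem_filter.2 ⟨hoB, hP.1⟩
      · exact mem_filter.2 ⟨hxB, hP.2.1⟩
    · rw [ind_of_false hP, zero_mul, zero_mul]
  calc ∑' n, ind (csources G Λ n = ∅ ∧ CSupp G Λ (edgesIn G Λ) n) * cweight G Λ β n *
        (ind (¬ h.ConnFix (h.fold n) o ∧ ¬ h.ConnFix (h.fold n) x ∧ h.ConnFix (h.fold n) y) *
          ENNReal.ofReal (isingTwoPoint G (B.filter fun v => ¬ h.ConnFix (h.fold n) v) β 0 .free o x))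
      ≤ ∑' n, ind (csources G Λ n = ∅ ∧ CSupp G Λ (edgesIn G Λ) n) * cweight G Λ β n *
          (ind (¬ h.ConnFix (h.fold n) o ∧ ¬ h.ConnFix (h.fold n) x ∧ h.ConnFix (h.fold n) y) *
            ENNReal.ofReal (isingTwoPoint G (h.gset n) β 0 .free o x)) :=
        ENNReal.tsum_le_tsum fun n => mul_le_mul_right (hS1 n) _
    _ = ∑' n, ind (csources G Λ n = {o} ∆ {x} ∧ CSupp G Λ (edgesIn G Λ) n) * cweight G Λ β n *
          ind (¬ h.ConnFix (h.fold n) o ∧ ¬ h.ConnFix (h.fold n) x ∧ h.ConnFix (h.fold n) y) :=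
        h.tsum_gset_markov hβ ho hx hyΛ hy'

/-- **Steps (1)–(2) on the even torus, per pair of box points.** For `β ≥ 0`, `n ≥ 1`, an even torus
`(ℤ/Lℤ)^d` with `4n + 2 ≤ L`, a direction `δ` and `x, y ∈ Λ_n`: the left side of the torus Lemma 2.5
(`DCPLower.lemma25_torus`) is at most the sourced-current event sum `Σ_{∂𝐧={0̄}∆{x̄}} w(𝐧) 𝟙[0̄ ↮ ℍ, x̄ ↮ ℍ, ȳ ↔ ℍ]`
(when `x̄` is on the hyperplane both indicators vanish). [cite: DuminilCopinPanis2025LowerBounds, Lemma 2.5 (proof, eqs. (2.21)–(2.22))] -/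
theorem torus_volume_markov_le {d : ℕ} (β : ℝ) (hβ : 0 ≤ β) (n : ℕ) (hn : 1 ≤ n)
    (L : ℕ) [NeZero L] (hL : Even L) (hnL : 4 * n + 2 ≤ L)
    (δ : Fin d × Bool) (x : Site d) (hx : x ∈ box d n) (y : Site d) (_hy : y ∈ box d n) :
    ∑' nc : edgesIn (torusGraph d L) univ → ℕ,
        ind (csources (torusGraph d L) univ nc = ∅ ∧
            CSupp (torusGraph d L) univ (edgesIn (torusGraph d L) univ) nc) *
          cweight (torusGraph d L) univ β nc *
          (ind (¬ (isFoldable_dir hL (by omega) n δ).ConnFix ((isFoldable_dir hL (by omega) n δ).fold nc)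
                  (Torus.proj L 0) ∧
                ¬ (isFoldable_dir hL (by omega) n δ).ConnFix ((isFoldable_dir hL (by omega) n δ).fold nc)
                  (Torus.proj L x) ∧
                (isFoldable_dir hL (by omega) n δ).ConnFix ((isFoldable_dir hL (by omega) n δ).fold nc)
                  (Torus.proj L y)) *
            ENNReal.ofReal (isingTwoPoint (torusGraph d L)
              (((box d n).filter fun z => ¬ (isFoldable_dir hL (by omega) n δ).ConnFix
                  ((isFoldable_dir hL (by omega) n δ).fold nc) (Torus.proj L z)).image (Torus.proj L))
              β 0 .free (Torus.proj L 0) (Torus.proj L x))) ≤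
      ∑' nc : edgesIn (torusGraph d L) univ → ℕ,
        ind (csources (torusGraph d L) univ nc = {Torus.proj L 0} ∆ {Torus.proj L x} ∧
            CSupp (torusGraph d L) univ (edgesIn (torusGraph d L) univ) nc) *
          cweight (torusGraph d L) univ β nc *
          ind (¬ (isFoldable_dir hL (by omega) n δ).ConnFix ((isFoldable_dir hL (by omega) n δ).fold nc)
                (Torus.proj L 0) ∧
              ¬ (isFoldable_dir hL (by omega) n δ).ConnFix ((isFoldable_dir hL (by omega) n δ).fold nc)
                (Torus.proj L x) ∧
              (isFoldable_dir hL (by omega) n δ).ConnFix ((isFoldable_dir hL (by omega) n δ).fold nc)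
                (Torus.proj L y)) := by
  set h := isFoldable_dir (d := d) hL (by omega : 2 < L) n δ
  rcases proj_mem_dirHalf_or_fixed hL hnL hx δ with hxH | hxfix
  · have hBfix : ∀ v ∈ (box d n).image (Torus.proj L), v ∈ dirHalf L n δ ∨ dirTheta L n δ v = v := by
      intro v hv
      obtain ⟨z, hz, rfl⟩ := mem_image.1 hv
      exact proj_mem_dirHalf_or_fixed hL hnL hz δ
    have key := foldable_volume_markov_le h hβ (B := (box d n).image (Torus.proj L)) (subset_univ _) hBfix
      (proj_zero_mem_dirHalf hL hn hnL δ) hxH (mem_image_of_mem _ (zero_mem_box d n))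
      (mem_image_of_mem _ hx) (mem_univ _) (proj_mem_dirHalf_or_fixed hL hnL _hy δ)
    refine le_of_eq_of_le (tsum_congr fun nc => ?_) key
    rw [Finset.filter_image]
  · have hzero : ∀ nc : edgesIn (torusGraph d L) univ → ℕ,
        ind (¬ h.ConnFix (h.fold nc) (Torus.proj L 0) ∧ ¬ h.ConnFix (h.fold nc) (Torus.proj L x) ∧
          h.ConnFix (h.fold nc) (Torus.proj L y)) = 0 := fun nc =>
      ind_of_false fun H => H.2.1 (h.connFix_of_fixed _ (mem_univ _) hxfix)
    simp only [hzero, zero_mul, mul_zero, tsum_zero, le_refl]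

/-- **Reduction of the engine to one sourced current.** For every `s, C`: if, for all `n ≥ 1`, all even
tori `L ≥ 4n + 2` and all directions `δ`, at `β_c(3)`,
`Σ_{x,y ∈ Λ_n, y∼x} Σ_{∂𝐧={0̄}∆{x̄}} w(𝐧) 𝟙[0̄ ↮ ℍ_δ, x̄ ↮ ℍ_δ, ȳ ↔ ℍ_δ] ≤ C n^{-s} Σ_{x,y ∈ Λ_n, y∼x} (Z^{0̄x̄} - Z^{0̄,θ_δx̄}) ⟨σ_ȳσ_{θ_δȳ}⟩_{𝕋_L}`
(the SCREENED SOURCED-EVENT bound: the sourced current's cluster misses the mirror while its sourceless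
loops join the neighbour `y` of `x` to the mirror — screened by that cluster; `s = 0`, `C = 1` is a theorem,
`screenedSourcedEvent_zero_one`), then the line's engine currency `ScreenedTorusLemma25 s C` holds (stated
unfolded: the left side of Lemma 2.5 summed over pairs is at most `C n^{-s}` times its summed right side).
Proof: termwise steps (1)–(2) (`torus_volume_markov_le`), then the hypothesis. [cite: DuminilCopinPanis2025LowerBounds, Lemma 2.5 (proof, eqs. (2.21)–(2.23))] -/
theorem screenedLemma25_of_screenedSourcedEvent (s C : ℝ)
    (hE' : ∀ (n : ℕ) (_hn : 1 ≤ n) (L : ℕ) [NeZero L] (hL : Even L) (hnL : 4 * n + 2 ≤ L) (δ : Fin 3 × Bool),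
      (∑ x ∈ box 3 n, ∑ y ∈ box 3 n,
        if (zdGraph 3).Adj x y then
          ∑' nc : edgesIn (torusGraph 3 L) univ → ℕ,
            ind (csources (torusGraph 3 L) univ nc = {Torus.proj L (0 : Site 3)} ∆ {Torus.proj L x} ∧
                CSupp (torusGraph 3 L) univ (edgesIn (torusGraph 3 L) univ) nc) *
              cweight (torusGraph 3 L) univ (criticalBeta 3) nc *
              ind (¬ (isFoldable_dir hL (by omega) n δ).ConnFix ((isFoldable_dir hL (by omega) n δ).fold nc)
                    (Torus.proj L (0 : Site 3)) ∧
                  ¬ (isFoldable_dir hL (by omega) n δ).ConnFix ((isFoldable_dir hL (by omega) n δ).fold nc)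
                    (Torus.proj L x) ∧
                  (isFoldable_dir hL (by omega) n δ).ConnFix ((isFoldable_dir hL (by omega) n δ).fold nc)
                    (Torus.proj L y))
        else 0) ≤
      ENNReal.ofReal (C * (n : ℝ) ^ (-s)) *
        ∑ x ∈ box 3 n, ∑ y ∈ box 3 n,
          if (zdGraph 3).Adj x y then
            (currentZ (torusGraph 3 L) univ (criticalBeta 3) (edgesIn (torusGraph 3 L) univ)
                  ({Torus.proj L (0 : Site 3)} ∆ {Torus.proj L x}) -
                currentZ (torusGraph 3 L) univ (criticalBeta 3) (edgesIn (torusGraph 3 L) univ)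
                  ({Torus.proj L (0 : Site 3)} ∆ {dirTheta L n δ (Torus.proj L x)})) *
              ENNReal.ofReal (isingTwoPoint (torusGraph 3 L) univ (criticalBeta 3) 0 .free (Torus.proj L y)
                (dirTheta L n δ (Torus.proj L y)))
          else 0) :
    ∀ (n : ℕ) (_hn : 1 ≤ n) (L : ℕ) [NeZero L] (hL : Even L) (hnL : 4 * n + 2 ≤ L) (δ : Fin 3 × Bool),
      (∑ x ∈ box 3 n, ∑ y ∈ box 3 n,
        if (zdGraph 3).Adj x y then
          ∑' nc : edgesIn (torusGraph 3 L) univ → ℕ,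
            ind (csources (torusGraph 3 L) univ nc = ∅ ∧
                CSupp (torusGraph 3 L) univ (edgesIn (torusGraph 3 L) univ) nc) *
              cweight (torusGraph 3 L) univ (criticalBeta 3) nc *
              (ind (¬ (isFoldable_dir hL (by omega) n δ).ConnFix ((isFoldable_dir hL (by omega) n δ).fold nc)
                      (Torus.proj L (0 : Site 3)) ∧
                    ¬ (isFoldable_dir hL (by omega) n δ).ConnFix ((isFoldable_dir hL (by omega) n δ).fold nc)
                      (Torus.proj L x) ∧
                    (isFoldable_dir hL (by omega) n δ).ConnFix ((isFoldable_dir hL (by omega) n δ).fold nc)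
                      (Torus.proj L y)) *
                ENNReal.ofReal (isingTwoPoint (torusGraph 3 L)
                  (((box 3 n).filter fun z => ¬ (isFoldable_dir hL (by omega) n δ).ConnFix
                      ((isFoldable_dir hL (by omega) n δ).fold nc) (Torus.proj L z)).image (Torus.proj L))
                  (criticalBeta 3) 0 .free (Torus.proj L (0 : Site 3)) (Torus.proj L x)))
        else 0) ≤
      ENNReal.ofReal (C * (n : ℝ) ^ (-s)) *
        ∑ x ∈ box 3 n, ∑ y ∈ box 3 n,
          if (zdGraph 3).Adj x y then
            (currentZ (torusGraph 3 L) univ (criticalBeta 3) (edgesIn (torusGraph 3 L) univ)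
                  ({Torus.proj L (0 : Site 3)} ∆ {Torus.proj L x}) -
                currentZ (torusGraph 3 L) univ (criticalBeta 3) (edgesIn (torusGraph 3 L) univ)
                  ({Torus.proj L (0 : Site 3)} ∆ {dirTheta L n δ (Torus.proj L x)})) *
              ENNReal.ofReal (isingTwoPoint (torusGraph 3 L) univ (criticalBeta 3) 0 .free (Torus.proj L y)
                (dirTheta L n δ (Torus.proj L y)))
          else 0 := by
  intro n hn L _ hL hnL δ
  refine le_trans (Finset.sum_le_sum fun x hx => Finset.sum_le_sum fun y hy => ?_) (hE' n hn L hL hnL δ)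
  split_ifs with hxy
  · exact torus_volume_markov_le (criticalBeta 3) (criticalBeta_nonneg 3) n hn L hL hnL δ x hx y hy
  · exact le_rfl

/-- **Calibration of the sourced-event bound: `s = 0`, `C = 1` is a theorem** — steps (3)–(5) of the proof
of Lemma 2.5 (conditioning on `𝒞(0)`, outer switching with Griffiths, un-conditioning: the tree's
`IsFoldable.tsum_pair_event_le`), summed over the neighbour pairs of `Λ_n` on the even torus at `β_c(3)`.
[cite: DuminilCopinPanis2025LowerBounds, Lemma 2.5 (proof, eqs. (2.22)–(2.23))] -/
theorem screenedSourcedEvent_zero_one :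
    ∀ (n : ℕ) (_hn : 1 ≤ n) (L : ℕ) [NeZero L] (hL : Even L) (hnL : 4 * n + 2 ≤ L) (δ : Fin 3 × Bool),
      (∑ x ∈ box 3 n, ∑ y ∈ box 3 n,
        if (zdGraph 3).Adj x y then
          ∑' nc : edgesIn (torusGraph 3 L) univ → ℕ,
            ind (csources (torusGraph 3 L) univ nc = {Torus.proj L (0 : Site 3)} ∆ {Torus.proj L x} ∧
                CSupp (torusGraph 3 L) univ (edgesIn (torusGraph 3 L) univ) nc) *
              cweight (torusGraph 3 L) univ (criticalBeta 3) nc *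
              ind (¬ (isFoldable_dir hL (by omega) n δ).ConnFix ((isFoldable_dir hL (by omega) n δ).fold nc)
                    (Torus.proj L (0 : Site 3)) ∧
                  ¬ (isFoldable_dir hL (by omega) n δ).ConnFix ((isFoldable_dir hL (by omega) n δ).fold nc)
                    (Torus.proj L x) ∧
                  (isFoldable_dir hL (by omega) n δ).ConnFix ((isFoldable_dir hL (by omega) n δ).fold nc)
                    (Torus.proj L y))
        else 0) ≤
      ENNReal.ofReal (1 * (n : ℝ) ^ (-(0 : ℝ))) *
        ∑ x ∈ box 3 n, ∑ y ∈ box 3 n,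
          if (zdGraph 3).Adj x y then
            (currentZ (torusGraph 3 L) univ (criticalBeta 3) (edgesIn (torusGraph 3 L) univ)
                  ({Torus.proj L (0 : Site 3)} ∆ {Torus.proj L x}) -
                currentZ (torusGraph 3 L) univ (criticalBeta 3) (edgesIn (torusGraph 3 L) univ)
                  ({Torus.proj L (0 : Site 3)} ∆ {dirTheta L n δ (Torus.proj L x)})) *
              ENNReal.ofReal (isingTwoPoint (torusGraph 3 L) univ (criticalBeta 3) 0 .free (Torus.proj L y)
                (dirTheta L n δ (Torus.proj L y)))
          else 0 := by
  intro n hn L _ hL hnL δ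
  rw [neg_zero, Real.rpow_zero, mul_one, ENNReal.ofReal_one, one_mul]
  refine Finset.sum_le_sum fun x hx => Finset.sum_le_sum fun y hy => ?_
  split_ifs with hxy
  · set h := isFoldable_dir (d := 3) hL (by omega : 2 < L) n δ
    rcases proj_mem_dirHalf_or_fixed hL hnL hx δ with hxH | hxfix
    · have key := h.tsum_pair_event_le (criticalBeta_nonneg 3) (proj_zero_mem_dirHalf hL hn hnL δ) hxH
        (mem_univ (Torus.proj L y)) (proj_mem_dirHalf_or_fixed hL hnL hy δ)
      exact key.trans (le_of_eq (mul_comm _ _))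
    · have hzero : ∀ nc : edgesIn (torusGraph 3 L) univ → ℕ,
          ind (¬ h.ConnFix (h.fold nc) (Torus.proj L 0) ∧ ¬ h.ConnFix (h.fold nc) (Torus.proj L x) ∧
            h.ConnFix (h.fold nc) (Torus.proj L y)) = 0 := fun nc =>
        ind_of_false fun H => H.2.1 (h.connFix_of_fixed _ (mem_univ _) hxfix)
      simp only [hzero, mul_zero, tsum_zero, zero_le]
  · exact le_rfl

end Summit.CriticalPhenomena.Ising3DConformalLimit.SubPtolemyFloorScreening

end
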